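import Literature.NumberTheory.EllipticCurves.RingClassFieldTwoTorsionProofs
import Literature.NumberTheory.EllipticCurves.TwoAdicImageSurjectivityModTwoProofs
import Literature.NumberTheory.EllipticCurves.HeegnerPointsKolyvaginPrimaryNoTorsionProofs
import Literature.NumberTheory.DiophantineGeometry.EllArithGlueProofs
import Literature.NumberTheory.DiophantineGeometry.ConductorRadicalProofs
import Summits.BirchSwinnertonDyer.Rank1Residual.X11b.RingClassFieldNoTorsion
import HarnessLib

/-!
# Route `KolyvaginRankRigidityAtTwo`, crux V1′ `KolyvaginNonvanishingAtTwoFrame`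
# (stmt-BirchSwinnertonDyer-24622): Gross 1991, Lemma 4.3 AT `p = 2` on the route's habitat —
# `E(K[n])[2] = 0` and the admissibility binder `hA` of McCallum's cocycle for `p = 2`

Width prover `bsd-line-krr2-p2` (g5), helper for the registered stub `stub_nonTorsionLevelOne`
(`--supports stmt-BirchSwinnertonDyer-24622`). THEOREMS ONLY (no definition, no named fact, no
`sorry`); BSD is not proved by any of this; Kolyvagin's conjecture at `2` is not asserted.

WHY. The tree's Kolyvagin class `d.kolyvaginClass hp M` (McCallum's cocycle, Gross 1991 (4.6)) is
the junk value `0` unless `A = E(K[n]) ⊆ E(K̄)` is `p^M`-ADMISSIBLE (`Γ_K`-stable and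
`p^M`-torsion-free: Gross's Lemma 4.3 *"The curve `E` has no `K_n`-rational `p`-torsion"*). The
tree supplies this binder for ODD `p` from `ρ̄_{E,p}` onto alone
(`RingClassNoTorsion.isAdmissible_pointsSubgroup`: "`GL₂(ℤ/p)` is not a quotient of a group of
dihedral type when `p > 2`"). AT `p = 2` that argument is void — `GL₂(𝔽₂) ≅ S₃` IS dihedral — and
`ρ̄_{E,2}` onto does NOT exclude `E(K[n])[2] ≠ 0` in general (e.g. `K = ℚ(√Δ_E)`, whose Hilbert
class field contains the cyclic cubic `K(E[2])`). What excludes it on the route's habitat is the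
HEEGNER HYPOTHESIS with `d_K` odd: a point of order `2` over the normal extension `K[n]/K` puts
`√Δ_E` in `K[n]` (tree: `exists_sq_eq_Δ_of_two_nsmul_eq_zero`, Dokchitser–Dokchitser 2012 (1)
"`ℚ(E[2]) ⊃ ℚ(√Δ)`"); writing `Δ_min = d·s²` with `d` square-free, either

* `d = 1`: `Δ ∈ ℚ^{×2}` contradicts `ρ̄_{E,2}` onto (tree: `hasSurjectiveModNGaloisRep_two_iff`);
* `d = −1`: `√−1 ∈ K[n]`, impossible for `2 ∤ n·d_K` — `K[n]/K` is unramified outside `n` (Cox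
  §9.A, tree `isUnramifiedIn_ringClassField`) and `K/ℚ` is unramified at `2`, so a prime `w ∣ 2` of
  `K[n]` has `e(w|2) = 1`, while `(1 + i)² = 2i` forces `ord_w 2` to be even
  (`sqrt_neg_one_not_mem_ringClassField`, this file);
* `d` has a prime factor `q`: `q ∥ d`, `q ∣ Δ_min` so `q ∣ N_E` (tree: `radical_conductorNorm_eq_holds`),
  hence `q` SPLITS in `K` (Heegner) and `q ∤ d_K` (tree: `not_dvd_discr_of_ncard_primesOver_eq_two`),
  and `q ∤ n` for `n` prime to `N_E`; then the tree's genus-theory non-membership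
  `twoTorsion_eq_zero_ringClassField` (`√d ∉ K[n]`, Cox §9.A) concludes.

## Main statements

* `sqrt_neg_one_not_mem_ringClassField` — `i ∉ K[m]` for `K` imaginary quadratic, `2 ∤ m`, `2 ∤ d_K`.
* `twoTorsion_eq_zero_ringClassField_of_heegner` — `E(K[n])[2] = 0` for `W/ℚ` elliptic globally
  minimal with `ρ̄_{E,2}` onto, `K` imaginary quadratic with `d_K` odd and the Heegner hypothesis for
  `N_E`, `n ≠ 0` odd and prime to `N_E` (e.g. `n = 1`, or a square-free product of Kolyvagin primes
  at `2`).
* `torsionBy_two_pow_ringClassField_eq_bot_of_heegner`,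
  `eq_zero_of_zsmul_two_pow_eq_zero_ringClassField_of_heegner` — `E(K[n])[2^M] = 0`.
* `isAdmissible_pointsSubgroup_two` — the `hA` binder of `KolyvaginHeegnerData.kolyvaginClass` at
  `p = 2`: `KolyvaginCocycle.IsAdmissible Γ_K (E(K[n]) ⊆ E(K̄)) 2^M` for every concrete datum `d`.

## References

* B. H. Gross, *Kolyvagin's work on modular elliptic curves*, LMS LNS 153 (1991), §4 Lemma 4.3.
  [GrossLMS1991]
* W. G. McCallum, *Kolyvagin's work on Shafarevich–Tate groups*, ibid., §4 (5). [McCallumLMS1991]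
* T. Dokchitser, V. Dokchitser, *Surjectivity of mod `2ⁿ` representations of elliptic curves*,
  Math. Z. 272 (2012), Theorem (1) and its proof. [DokchitserDokchitserMathZ2012]
* D. A. Cox, *Primes of the form x² + ny²*, 2nd ed. (2013), §9.A. [Cox2013]
* J. Neukirch, *Algebraic Number Theory* (1999), Ch. III Cor. (2.12). [NeukirchANT1999]
-/

set_option autoImplicit false
-- the Theorems namespace of this sub repeats the summit name by design (D-0017 nested layout)
set_option linter.dupNamespace false

noncomputable section

open scoped Classical

namespace Summit.BirchSwinnertonDyer.BirchSwinnertonDyer.Theorems.KolyvaginRankRigidity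

open NumberField IsDedekindDomain Field WeierstrassCurve
open Literature.NumberTheory.EllipticCurves Literature.NumberTheory.GaloisRepresentations
open Literature.NumberTheory.NumberFields
open Summit.BirchSwinnertonDyer.Rank1Residual.X11b

variable {K : Type} [Field K] [NumberField K]

/-! ## §1 `√−1 ∉ K[m]` when `2 ∤ m` and `2 ∤ d_K` -/

/-- **`√−1 ∉ K[m]` for `2 ∤ m d_K`.** For `K` imaginary quadratic with `2 ∤ d_K`, `ι : K → ℂ` and
`m ≥ 1` odd, no complex square root of `−1` lies in the ring class field `K[m]`: a prime `w ∣ 2` of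
`K[m]` is unramified over `v = w ∩ 𝓞_K` (Cox §9.A: the primes of `K` ramified in `K[m]` divide `m`;
tree `isUnramifiedIn_ringClassField`) and `v` is unramified over `2` (`2 ∤ d_K`, Dedekind), so
`ord_w 2 = 1`; but `i ∈ K[m]` gives `(1 + i)² = 2i` with `i` a unit, so `ord_w 2 = 2 ord_w (1 + i)`
would be even. [cite: Cox2013, §9.A (p. 180)] [cite: NeukirchANT1999, Ch. III Cor. (2.12)] -/
theorem sqrt_neg_one_not_mem_ringClassField (hK : IsImaginaryQuadratic K) (ι : K →+* ℂ) {m : ℕ}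
    (hm : m ≠ 0) (h2m : ¬ 2 ∣ m) (h2D : ¬ (2 : ℤ) ∣ NumberField.discr K) (r : ℂ)
    (hr : r ^ 2 = -1) : r ∉ ringClassField K ι m := by
  classical
  intro hrL
  set L := ringClassField K ι m with hLdef
  haveI := (finiteDimensional_and_isGalois_ringClassField hK ι hm).1
  haveI : NumberField L := NumberField.of_module_finite K L
  have hℓ : Nat.Prime 2 := Nat.prime_two
  have hℓZ : Prime ((2 : ℕ) : ℤ) := Nat.prime_iff_prime_int.mp hℓ
  haveI hmax : (Ideal.span {((2 : ℕ) : ℤ)}).IsMaximal :=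
    ((Ideal.span_singleton_prime hℓZ.ne_zero).mpr hℓZ).isMaximal
      (by rw [Ne, Ideal.span_singleton_eq_bot]; exact hℓZ.ne_zero)
  obtain ⟨P, hPmax, hPover⟩ :=
    Ideal.exists_maximal_ideal_liesOver_of_isIntegral (R := ℤ) (S := 𝓞 L)
      (Ideal.span {((2 : ℕ) : ℤ)})
  have hPbot : P ≠ ⊥ :=
    Ring.ne_bot_of_isMaximal_of_not_isField hPmax (RingOfIntegers.not_isField L)
  set w : HeightOneSpectrum (𝓞 L) := ⟨P, hPmax.isPrime, hPbot⟩ with hwdef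
  have h2w : ((2 : ℕ) : 𝓞 L) ∈ w.asIdeal := by
    have : algebraMap ℤ (𝓞 L) ((2 : ℕ) : ℤ) ∈ P := by
      rw [← Ideal.mem_comap, ← Ideal.under_def, ← hPover.over]
      exact Ideal.mem_span_singleton_self _
    simpa using this
  set v : HeightOneSpectrum (𝓞 K) := w.under (𝓞 K) with hvdef
  haveI hwv : w.asIdeal.LiesOver v.asIdeal := ⟨rfl⟩
  have h2v : ((2 : ℕ) : 𝓞 K) ∈ v.asIdeal := by
    change algebraMap (𝓞 K) (𝓞 L) ((2 : ℕ) : 𝓞 K) ∈ w.asIdeal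
    rw [map_natCast]; exact h2w
  -- `e(v | 2) = 1` since `2 ∤ d_K`
  haveI hunrv : Algebra.IsUnramifiedAt ℤ v.asIdeal :=
    (NumberField.not_dvd_discr_iff_forall_mem K (𝓞 K) hℓZ).mp (by exact_mod_cast h2D) v.asIdeal
      inferInstance (by exact_mod_cast h2v)
  -- `e(w | v) = 1` since `v ∤ m`
  have hvm : ¬ Ideal.span {((m : ℕ) : 𝓞 K)} ≤ v.asIdeal := by
    intro hle
    have hmv : ((m : ℤ) : 𝓞 K) ∈ v.asIdeal := by
      have := (Ideal.span_singleton_le_iff_mem _).mp hle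
      simpa using this
    exact h2m (by exact_mod_cast (intCast_mem_asIdeal_iff_of_natCast_mem hℓ v h2v (m : ℤ)).mp hmv)
  haveI hunrw : Algebra.IsUnramifiedAt (𝓞 K) w.asIdeal :=
    isUnramifiedIn_ringClassField hK ι hm hvm w.asIdeal w.isPrime hwv
  haveI : Algebra.IsUnramifiedAt ℤ w.asIdeal :=
    Algebra.IsUnramifiedAt.comp (R := ℤ) (A := 𝓞 K) v.asIdeal w.asIdeal
  have he : w.asIdeal.ramificationIdx ℤ = 1 := Ideal.ramificationIdx_eq_one_of_isUnramifiedAt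
  -- the place `(2)` of `ℤ` below `w`: `ord_w 2 = e(w|2) · ord_2 2 = 1`
  have hbot : Ideal.span {((2 : ℕ) : ℤ)} ≠ ⊥ := by
    rw [ne_eq, Ideal.span_singleton_eq_bot]; exact hℓZ.ne_zero
  set u : HeightOneSpectrum ℤ := ⟨Ideal.span {((2 : ℕ) : ℤ)}, hmax.isPrime, hbot⟩ with hu
  haveI hlo : w.asIdeal.LiesOver u.asIdeal := liesOver_span_of_natCast_mem_asIdeal hℓ w h2w
  have he' : u.asIdeal.ramificationIdx' w.asIdeal = 1 := by
    rw [Ideal.ramificationIdx'_eq_ramificationIdx u.asIdeal w.asIdeal hbot]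
    exact he
  have hu2 : u.intValuation ((2 : ℕ) : ℤ) = WithZero.exp (-1 : ℤ) :=
    HeightOneSpectrum.intValuation_singleton (v := u) hℓZ.ne_zero rfl
  have hw2 : w.intValuation (((2 : ℕ) : ℤ) : 𝓞 L) = WithZero.exp (-1 : ℤ) := by
    have h := HeightOneSpectrum.intValuation_liesOver u w ((2 : ℕ) : ℤ)
    rw [he', pow_one, hu2] at h
    rw [← map_intCast (algebraMap ℤ (𝓞 L))]
    exact h.symm
  have hval2 : w.valuation L (2 : L) = WithZero.exp (-1 : ℤ) := by
    have h2 : (2 : L) = algebraMap (𝓞 L) L (((2 : ℕ) : ℤ) : 𝓞 L) := by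
      push_cast
      exact (map_ofNat (algebraMap (𝓞 L) L) 2).symm
    rw [h2, HeightOneSpectrum.valuation_of_algebraMap, hw2]
  -- the element `i ∈ L` with `i² = −1`: a unit at `w`
  set i : L := ⟨r, hrL⟩ with hidef
  have hi2 : i ^ 2 = -1 := by
    apply Subtype.ext
    have : ((i ^ 2 : L) : ℂ) = r ^ 2 := by simp [hidef]
    rw [this, hr]
    simp
  have hvali : w.valuation L i = 1 := by
    have hsq : (w.valuation L i) ^ 2 = 1 := by
      rw [← map_pow, hi2, Valuation.map_neg, map_one]
    have hi0 : w.valuation L i ≠ 0 := by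
      intro h0
      rw [h0, zero_pow two_ne_zero] at hsq
      exact zero_ne_one hsq
    have hlog : WithZero.log (w.valuation L i) = 0 := by
      have := congrArg WithZero.log hsq
      rw [WithZero.log_pow, WithZero.log_one, smul_eq_zero] at this
      exact this.resolve_left two_ne_zero
    rw [← WithZero.exp_log hi0, hlog, WithZero.exp_zero]
  -- `(1 + i)² = 2 i`: `2 ord_w (1 + i) = ord_w 2 = 1`, absurd
  have hx2 : (1 + i) ^ 2 = 2 * i := by linear_combination hi2
  have hvx : (w.valuation L (1 + i)) ^ 2 = WithZero.exp (-1 : ℤ) := by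
    rw [← map_pow, hx2, map_mul, hval2, hvali, mul_one]
  have hx0 : w.valuation L (1 + i) ≠ 0 := by
    intro h0
    rw [h0, zero_pow two_ne_zero] at hvx
    exact WithZero.coe_ne_zero hvx.symm
  have hlog := congrArg WithZero.log hvx
  rw [WithZero.log_pow, WithZero.log_exp] at hlog
  simp only [nsmul_eq_mul, Nat.cast_ofNat] at hlog
  omega

/-! ## §2 `E(K[n])[2] = 0` on the Heegner habitat with `d_K` odd -/

/-- The minimal discriminant of a globally minimal `W/ℚ` is `d·s²` with `d` a square-free integer
and `s` a natural number (`Δ_min = sign(Δ_min)·b²·a`, `a` square-free, Mathlib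
`Nat.sq_mul_squarefree`), and every prime factor of `d` divides the conductor `N_E` (the tree's
`radical_conductorNorm_eq_holds`: `N_E` and `|Δ_min|` have the same prime factors).
[cite: SilvermanAEC2009, VIII.11 (p. 221: the primes dividing Δ_min are the bad primes)] -/
theorem exists_Δ_eq_squarefree_mul_sq (W : WeierstrassCurve ℚ) [W.IsElliptic]
    [W.IsGloballyMinimal] :
    ∃ (d : ℤ) (s : ℕ), Squarefree d ∧ s ≠ 0 ∧ W.Δ = d * (s : ℚ) ^ 2 ∧
      ∀ q : ℕ, q.Prime → (q : ℤ) ∣ d → q ∣ W.conductorNorm ℤ := by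
  set Δ : ℤ := minimalDiscriminantInt W with hΔdef
  have hΔ0 : Δ ≠ 0 := minimalDiscriminantInt_ne_zero W
  have hcast : (Δ : ℚ) = W.Δ := cast_minimalDiscriminantInt W
  obtain ⟨a, b, hba, ha⟩ := Nat.sq_mul_squarefree Δ.natAbs
  have hb0 : b ≠ 0 := by
    rintro rfl
    apply hΔ0
    rw [← Int.natAbs_eq_zero, ← hba]
    simp
  have ha0 : a ≠ 0 := by
    rintro rfl
    apply hΔ0
    rw [← Int.natAbs_eq_zero, ← hba]
    simp
  set d : ℤ := Int.sign Δ * a with hddef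
  have hΔd : Δ = d * (b : ℤ) ^ 2 := by
    have h1 : (Δ.natAbs : ℤ) = (b : ℤ) ^ 2 * a := by rw [← hba]; push_cast; ring
    calc Δ = Int.sign Δ * (Δ.natAbs : ℤ) := (Int.sign_mul_natAbs Δ).symm
      _ = d * (b : ℤ) ^ 2 := by rw [h1, hddef]; ring
  have hdabs : d.natAbs = a := by
    rw [hddef, Int.natAbs_mul, Int.natAbs_sign_of_ne_zero hΔ0, one_mul, Int.natAbs_natCast]
  refine ⟨d, b, ?_, hb0, ?_, ?_⟩
  · rwa [← Int.squarefree_natAbs, hdabs]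
  · rw [← hcast, hΔd]; push_cast; ring
  · intro q hq hqd
    have hqa : q ∣ a := by rw [← hdabs]; exact Int.natCast_dvd.mp hqd
    have hqΔ : q ∣ Δ.natAbs := hqa.trans ⟨b ^ 2, by rw [← hba]; ring⟩
    have hnorm : W.minimalDiscriminantNorm ℤ = Δ.natAbs :=
      minimalDiscriminantNorm_int_eq_natAbs_minimalDiscriminantInt_holds W
    have hrad := radical_conductorNorm_eq_holds W
    have h1 : q ∣ UniqueFactorizationMonoid.radical (W.minimalDiscriminantNorm ℤ) := by
      rw [hnorm]
      exact (UniqueFactorizationMonoid.dvd_radical_iff_of_irreducible hq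
        (Int.natAbs_ne_zero.mpr hΔ0)).mpr hqΔ
    rw [← hrad] at h1
    exact h1.trans UniqueFactorizationMonoid.radical_dvd_self

/-- **Gross 1991, Lemma 4.3 AT `p = 2` on the Heegner habitat: `E(K[n])[2] = 0`.** Let `W/ℚ` be a
globally minimal elliptic curve with `ρ̄_{E,2}` onto `Aut(E[2]) ≅ S₃`, `K` an imaginary quadratic
field with `d_K` odd satisfying the Heegner hypothesis for `N_E`, `ι : K → ℂ`, and `n ≠ 0` odd and
prime to `N_E`. Then every `P ∈ E(K[n])` with `2P = O` is `O`. Proof: by cases on the square class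
`d` of `Δ_min` (`exists_Δ_eq_squarefree_mul_sq`) as in the module docstring — `d = 1` contradicts
surjectivity (D–D (1)), `d = −1` puts `√−1` in `K[n]` (`exists_sq_eq_Δ_of_two_nsmul_eq_zero`,
excluded by `sqrt_neg_one_not_mem_ringClassField`), and a prime `q ∣ d` is a bad prime, split in
`K` by the Heegner hypothesis, so `q ∤ d_K` and the tree's `twoTorsion_eq_zero_ringClassField`
applies. [cite: GrossLMS1991, §4 Lemma 4.3] [cite: DokchitserDokchitserMathZ2012, Theorem (1)]
[cite: Cox2013, §9.A] -/
theorem twoTorsion_eq_zero_ringClassField_of_heegner (W : WeierstrassCurve ℚ) [W.IsElliptic]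
    [W.IsGloballyMinimal] (hs : W.HasSurjectiveModNGaloisRep 2) (hK : IsImaginaryQuadratic K)
    (ι : K →+* ℂ) (hodd : ¬ (2 : ℤ) ∣ NumberField.discr K)
    (hH : SatisfiesHeegnerHypothesis (W.conductorNorm ℤ) K) {n : ℕ} (hn : n ≠ 0) (h2n : ¬ 2 ∣ n)
    (hNn : Nat.Coprime (W.conductorNorm ℤ) n)
    (P : (W.baseChange (ringClassField K ι n)).toAffine.Point) (hP : 2 • P = 0) : P = 0 := by
  obtain ⟨d, s, hdsq, hs0, hΔ, hbad⟩ := exists_Δ_eq_squarefree_mul_sq W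
  by_cases hd1 : d.natAbs = 1
  · -- `d = ±1`
    rcases Int.natAbs_eq d with hd | hd <;> rw [hd1, Nat.cast_one] at hd
    · -- `d = 1`: `Δ` is a rational square, contradicting `ρ̄_{E,2}` onto
      exfalso
      exact ((hasSurjectiveModNGaloisRep_two_iff W).mp hs).2 ⟨s, by rw [hΔ, hd]; ring⟩
    · -- `d = -1`: `√Δ = s·i ∈ K[n]`, so `i ∈ K[n]`
      by_contra hP0
      haveI := (finiteDimensional_and_isGalois_ringClassField hK ι hn).1
      haveI := (finiteDimensional_and_isGalois_ringClassField hK ι hn).2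
      obtain ⟨r, hr⟩ := exists_sq_eq_Δ_of_two_nsmul_eq_zero W (L := ringClassField K ι n) hs hK.1
        hP0 (by convert hP)
      have hrC : ((r : ℂ)) ^ 2 = ((W.Δ : ℚ) : ℂ) := by
        have h' := congrArg (fun z : ringClassField K ι n ↦ (z : ℂ)) hr
        simpa using h'
      have hsC : ((s : ℕ) : ℂ) ≠ 0 := by exact_mod_cast hs0
      have hi : ((r : ℂ) / (s : ℂ)) ^ 2 = -1 := by
        rw [div_pow, hrC, hΔ, hd]
        push_cast
        field_simp
      exact sqrt_neg_one_not_mem_ringClassField hK ι hn h2n hodd _ hi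
        (div_mem r.2 (natCast_mem _ s)) 
  · -- `d` has a prime factor `q`, a bad prime: `q ∥ d`, `q ∤ d_K` (Heegner), `q ∤ n`
    obtain ⟨q, hq, hqd⟩ := Nat.exists_prime_and_dvd hd1
    have hqdZ : (q : ℤ) ∣ d := Int.natCast_dvd.mpr hqd
    have hq2d : ¬ (q : ℤ) ^ 2 ∣ d := by
      intro h
      have h' : (q : ℤ) * q ∣ d := by rw [← sq]; exact h
      have hu : IsUnit (q : ℤ) := hdsq _ h'
      rw [Int.isUnit_iff_natAbs_eq, Int.natAbs_natCast] at hu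
      exact hq.one_lt.ne' hu
    have hqN : q ∣ W.conductorNorm ℤ := hbad q hq hqdZ
    have hqK : ¬ (q : ℤ) ∣ NumberField.discr K :=
      not_dvd_discr_of_ncard_primesOver_eq_two hK.1 hq (hH q hq hqN)
    have hqn : ¬ q ∣ n := fun h ↦ hq.one_lt.ne' (Nat.eq_one_of_dvd_coprimes hNn hqN h)
    have hΔ' : W.Δ = d * (s : ℚ) ^ 2 := hΔ
    exact twoTorsion_eq_zero_ringClassField W hs hΔ' hq hqdZ hq2d hK ι hqK hn hqn P hP

/-- `ℤ`-scalar form of `twoTorsion_eq_zero_ringClassField_of_heegner` (`(2 : ℤ) • P = 0`).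
[cite: GrossLMS1991, §4 Lemma 4.3] -/
theorem twoTorsion_eq_zero_ringClassField_of_heegner_zsmul (W : WeierstrassCurve ℚ) [W.IsElliptic]
    [W.IsGloballyMinimal] (hs : W.HasSurjectiveModNGaloisRep 2) (hK : IsImaginaryQuadratic K)
    (ι : K →+* ℂ) (hodd : ¬ (2 : ℤ) ∣ NumberField.discr K)
    (hH : SatisfiesHeegnerHypothesis (W.conductorNorm ℤ) K) {n : ℕ} (hn : n ≠ 0) (h2n : ¬ 2 ∣ n)
    (hNn : Nat.Coprime (W.conductorNorm ℤ) n)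
    (P : (W.baseChange (ringClassField K ι n)).toAffine.Point) (hP : (2 : ℤ) • P = 0) : P = 0 :=
  twoTorsion_eq_zero_ringClassField_of_heegner W hs hK ι hodd hH hn h2n hNn P
    (by rwa [← natCast_zsmul, Nat.cast_ofNat])

/-- **`E(K[n])[2] = 0` as a subgroup** (Gross 1991, Lemma 4.3 at `p = 2` on the Heegner habitat).
[cite: GrossLMS1991, §4 Lemma 4.3] -/
theorem torsionBy_two_ringClassField_eq_bot_of_heegner (W : WeierstrassCurve ℚ) [W.IsElliptic]
    [W.IsGloballyMinimal] (hs : W.HasSurjectiveModNGaloisRep 2) (hK : IsImaginaryQuadratic K)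
    (ι : K →+* ℂ) (hodd : ¬ (2 : ℤ) ∣ NumberField.discr K)
    (hH : SatisfiesHeegnerHypothesis (W.conductorNorm ℤ) K) {n : ℕ} (hn : n ≠ 0) (h2n : ¬ 2 ∣ n)
    (hNn : Nat.Coprime (W.conductorNorm ℤ) n) :
    AddSubgroup.torsionBy (W.baseChange (ringClassField K ι n)).toAffine.Point (2 : ℤ) = ⊥ := by
  rw [eq_bot_iff]
  intro P hP
  rw [AddSubgroup.mem_bot]
  exact twoTorsion_eq_zero_ringClassField_of_heegner_zsmul W hs hK ι hodd hH hn h2n hNn P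
    ((Submodule.mem_torsionBy_iff (2 : ℤ) P).mp hP)

/-- **McCallum 1991, §4 (5) at `p = 2` on the Heegner habitat: `E(K[n])[2^M] = 0`** (no `2`-torsion
⇒ no `2^M`-torsion, tree `torsionBy_pow_eq_bot`). [cite: McCallumLMS1991, §4 (5)]
[cite: GrossLMS1991, §4 Lemma 4.3] -/
theorem torsionBy_two_pow_ringClassField_eq_bot_of_heegner (W : WeierstrassCurve ℚ) [W.IsElliptic]
    [W.IsGloballyMinimal] (hs : W.HasSurjectiveModNGaloisRep 2) (hK : IsImaginaryQuadratic K)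
    (ι : K →+* ℂ) (hodd : ¬ (2 : ℤ) ∣ NumberField.discr K)
    (hH : SatisfiesHeegnerHypothesis (W.conductorNorm ℤ) K) {n : ℕ} (hn : n ≠ 0) (h2n : ¬ 2 ∣ n)
    (hNn : Nat.Coprime (W.conductorNorm ℤ) n) (M : ℕ) :
    AddSubgroup.torsionBy (W.baseChange (ringClassField K ι n)).toAffine.Point ((2 ^ M : ℕ) : ℤ) =
      ⊥ :=
  torsionBy_pow_eq_bot (p := 2)
    (torsionBy_two_ringClassField_eq_bot_of_heegner W hs hK ι hodd hH hn h2n hNn) M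

/-- **`E(K[n])` has no `2^M`-torsion, element form** (the `htor` hypothesis of
`Koly.pDiv_one_iff_exists_zsmul_eq`, McCallum 1991 proof of Lemma 5.1 *"since `E(K_1)` has no
`p`-torsion"*, at `p = 2`): `2^M • R = 0 ⇒ R = 0`. [cite: McCallumLMS1991, §4 (5), §5 Lemma 5.1] -/
theorem eq_zero_of_zsmul_two_pow_eq_zero_ringClassField_of_heegner (W : WeierstrassCurve ℚ)
    [W.IsElliptic] [W.IsGloballyMinimal] (hs : W.HasSurjectiveModNGaloisRep 2)
    (hK : IsImaginaryQuadratic K) (ι : K →+* ℂ) (hodd : ¬ (2 : ℤ) ∣ NumberField.discr K)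
    (hH : SatisfiesHeegnerHypothesis (W.conductorNorm ℤ) K) {n : ℕ} (hn : n ≠ 0) (h2n : ¬ 2 ∣ n)
    (hNn : Nat.Coprime (W.conductorNorm ℤ) n) (M : ℕ)
    (R : (W.baseChange (ringClassField K ι n)).toAffine.Point) (hR : ((2 ^ M : ℕ) : ℤ) • R = 0) :
    R = 0 := by
  have h : R ∈ AddSubgroup.torsionBy (W.baseChange (ringClassField K ι n)).toAffine.Point
      ((2 ^ M : ℕ) : ℤ) := (Submodule.mem_torsionBy_iff ((2 ^ M : ℕ) : ℤ) R).mpr hR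
  rwa [torsionBy_two_pow_ringClassField_eq_bot_of_heegner W hs hK ι hodd hH hn h2n hNn M,
    AddSubgroup.mem_bot] at h

/-! ## §3 The `hA` binder of McCallum's cocycle at `p = 2` -/

section KolyvaginHeegnerData

open Literature.NumberTheory.EllipticCurves.ModularForms

variable {N : ℕ} [NeZero N] {W : WeierstrassCurve ℚ} {Dt : ModularParametrizationData W N} {β : ℤ}
  {ι : K →+* ℂ} {n : ℕ} (d : KolyvaginHeegnerData Dt β ι n)

/-- **The `hA` binder of `KolyvaginHeegnerData.kolyvaginClass` AT `p = 2`** — admissibility of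
`E(K[n]) ⊆ E(K̄)` for `2^M` (printed `A = E(K_n)`; McCallum 1991 §4 (5), Gross 1991 Lemma 4.3 and
(4.2)): for `W/ℚ` globally minimal elliptic with `ρ̄_{E,2}` onto, `K` imaginary quadratic with `d_K`
odd and the Heegner hypothesis for `N_E`, and a concrete Kolyvagin–Heegner datum `d` at a level
`n ≠ 0` odd and prime to `N_E`, the subgroup `d.pointsSubgroup = d.toGeomPoints (E(K[n]))` is
`Γ_K`-stable (`RingClassNoTorsion.smul_toGeomPoints_eq`, any `p`) and `2^M`-torsion-free
(`torsionBy_two_pow_ringClassField_eq_bot_of_heegner`). With this binder `d.kolyvaginClass _ M`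
at `p = 2` is McCallum's class, not the junk value. [cite: McCallumLMS1991, §4 (5)]
[cite: GrossLMS1991, §4 Lemma 4.3 and (4.2)] -/
theorem isAdmissible_pointsSubgroup_two [W.IsElliptic] [W.IsGloballyMinimal]
    (hs : W.HasSurjectiveModNGaloisRep 2) (hK : IsImaginaryQuadratic K)
    (hodd : ¬ (2 : ℤ) ∣ NumberField.discr K)
    (hH : SatisfiesHeegnerHypothesis (W.conductorNorm ℤ) K) (hn : n ≠ 0) (h2n : ¬ 2 ∣ n)
    (hNn : Nat.Coprime (W.conductorNorm ℤ) n) (M : ℕ) :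
    KolyvaginCocycle.IsAdmissible (absoluteGaloisGroup K) d.pointsSubgroup ((2 ^ M : ℕ) : ℤ) where
  smul_mem g := by
    rintro _ ⟨P, rfl⟩
    exact ⟨_, (RingClassNoTorsion.smul_toGeomPoints_eq d hK hn g P).symm⟩
  eq_zero_of_zsmul := by
    rintro _ ⟨P, rfl⟩ hP
    rw [← map_zsmul] at hP
    have hP0 : ((2 ^ M : ℕ) : ℤ) • P = 0 :=
      (Affine.Point.map_injective (W' := W) d.emb.toRatAlgHom) (by rw [map_zero]; exact hP)
    rw [eq_zero_of_zsmul_two_pow_eq_zero_ringClassField_of_heegner W hs hK ι hodd hH hn h2n hNn M P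
      hP0, map_zero]

end KolyvaginHeegnerData

end Summit.BirchSwinnertonDyer.BirchSwinnertonDyer.Theorems.KolyvaginRankRigidity

end
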